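import Summits.ResolutionOfSingularities.ResolutionOfSingularities.Theorems.HilbertSamuelEliminationSigmaMaxModificationsCorridor3WLadderIsoInsepTailCutDefs
import Summits.ResolutionOfSingularities.ResolutionOfSingularities.Theorems.HilbertSamuelEliminationSigmaMaxModificationsCorridor3WLadderIsoTailsFreeRationalArcLimit
import HarnessLib

/-!
# [OURS · L1 W4.2] k2 `T3insep` at `p = 2` — the RC route's K1 INPUT DISCHARGED: `IsoInsepTowerTerminates 2 3` from E0, E1, k2c, RC,
# E2-propagation and K3 ALONE (K1 = `IsoFreeRationalTailsImpossible 2 3` is a theorem, `IsoTailsHS.isoFreeRationalTailsImpossible_holds`)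
# (crux `SigmaMaxModifications` stmt-ResolutionOfSingularities-18506 / conjunct stmt-…-19249; line `w_ladder_rows` v8.5, registered stub
# `stub_isoInsepTower`; res-D-pv-042's tail cut `…WLadderIsoInsepTailCutDefs` §2b/§2c)

Prover res-L1-w42-stub-2 (gen 5). Helper file `--supports stmt-ResolutionOfSingularities-19249 --as helper`; pure logic over landed rows, no
definitions, no named fact. OURS (cell res-hironaka, slot W4.2); NOT statements of [Hironaka2017] nor of [CossartJannsenSaito2020] /
[CossartPiltant2009]. AI-written; AI review is weaker than expert review.

res-D-pv-042's joins `isoInsepE2TailImpossible₂_of_RC_K1_K3`, `isoInsepE2DoubleRecurrentImpossible₂_of_RC_K1_K3`, `e2Tail_satelliteRecurrent_of_K1`,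
`isoInsepTowerTerminates₂_of_RC_K1_K3` (tri-2 r10: «the E2 cell sits inside K1 ∪ K3») take K1 as a hypothesis; at the level of record `N = 3`
that hypothesis is now the theorem `IsoTailsHS.isoFreeRationalTailsImpossible_holds 2` (ROUTE G v2 «ARC LIMIT», every embedding dimension). This file
restates the four joins WITHOUT the K1 binder.

* `isoInsepE2TailImpossible₂_of_RC_K3`, `isoInsepE2DoubleRecurrentImpossible₂_of_RC_K3`, `e2Tail_satelliteRecurrent` — every E2 tail at level 3
  is satellite-recurrent; with K3 there is none;
* **`isoInsepTowerTerminates₂_of_RC_K3`** — `E0 → E1 → k2c → RC → E2-propagation → K3 → IsoInsepTowerTerminates 2 3`.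

[OURS · L1 W4.2; AI-written] [cite: CossartPiltant2009, ch. 3 I.10 (Dis)] [cite: CossartJannsenSaito2020, Def. 6.38]
-/

set_option linter.dupNamespace false

noncomputable section

open Literature.AlgebraicGeometry.CossartJannsenSaito2020
open Summit.ResolutionOfSingularities.ResolutionOfSingularities.Theorems.CampaignW42
open Summit.ResolutionOfSingularities.ResolutionOfSingularities.Theorems.SigmaMaxModificationsCorridor3
open Summit.ResolutionOfSingularities.ResolutionOfSingularities.Cruxes.SigmaMaxModifications.IdeasL1Idea2R4 (IsIsoPointTower)
open Summit.ResolutionOfSingularities.ResolutionOfSingularities.Cruxes.SigmaMaxModifications.IdeasL1C5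

namespace Summit.ResolutionOfSingularities.ResolutionOfSingularities.Cruxes.SigmaMaxModifications.IdeasL1C6

universe u

/-- **Every E2 tail is excluded by RC, propagation and K3** (K1 discharged at level `3`). [OURS · L1 W4.2; AI-written]
[cite: CossartPiltant2009, ch. 3 I.10 (Dis)] -/
theorem isoInsepE2TailImpossible₂_of_RC_K3 (hRC : IsoInsepE2SuccRational₂.{u} 3) (hP : IsoInsepE2Propagates₂.{u} 3)
    (hK3 : IsoSatelliteRecurrentImpossible.{u} 2 3) : IsoInsepE2TailImpossible₂.{u} 3 :=
  isoInsepE2TailImpossible₂_of_RC_K1_K3 hRC hP (IsoTailsHS.isoFreeRationalTailsImpossible_holds 2) hK3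

/-- **No E2-double-recurrent isolated tower, from RC, propagation and K3** (K1 discharged at level `3`). [OURS · L1 W4.2; AI-written]
[cite: CossartPiltant2009, ch. 3 I.10 (Dis)] -/
theorem isoInsepE2DoubleRecurrentImpossible₂_of_RC_K3 (hRC : IsoInsepE2SuccRational₂.{u} 3) (hP : IsoInsepE2Propagates₂.{u} 3)
    (hK3 : IsoSatelliteRecurrentImpossible.{u} 2 3) : IsoInsepE2DoubleRecurrentImpossible₂.{u} 3 :=
  isoInsepE2DoubleRecurrentImpossible₂_of_RC_K1_K3 hRC hP (IsoTailsHS.isoFreeRationalTailsImpossible_holds 2) hK3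

/-- **Every E2 tail at level `3` is satellite-recurrent** (RC + propagation; K1 discharged) — the typed form of «T2ℓ ⊆ K3|_{E2}», now
unconditional in K1. [OURS · L1 W4.2; AI-written] [cite: CossartPiltant2009, ch. 3 I.10 (Dis)] -/
theorem e2Tail_satelliteRecurrent (hRC : IsoInsepE2SuccRational₂.{u} 3) (hP : IsoInsepE2Propagates₂.{u} 3)
    {ν : ℕ → ℕ} {T : BlowupTower.{u}} {pt : ∀ n, T.X n} (hO : IsMaximalOrigin 2 3 ν (T.X 0) (pt 0)) (hT : IsIsoPointTower 3 ν T pt)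
    {n₀ : ℕ} (h₀ : IsE2Stage T pt n₀) : ∀ n₁, ∃ n, n₁ ≤ n ∧ IsSatelliteStep T pt n :=
  e2Tail_satelliteRecurrent_of_K1 hRC hP (IsoTailsHS.isoFreeRationalTailsImpossible_holds 2) hO hT h₀

/-- **k2 AT `p = 2`, LEVEL `3`, ALONG THE RC ROUTE — K1 DISCHARGED:** `E0 → E1 → k2c → RC → E2-propagation → K3 →
IdeasL1C5.IsoInsepTowerTerminates 2 3` (res-D-pv-042's `isoInsepTowerTerminates₂_of_RC_K1_K3` with its K1 binder fed by
`IsoTailsHS.isoFreeRationalTailsImpossible_holds 2`). The rows proper to k2 on this route are E0, E1, k2c, RC and E2-propagation; the only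
shared kernel left is K3 = `IsoSatelliteRecurrentImpossible 2 3`. [OURS · L1 W4.2; AI-written] [cite: CossartPiltant2009, ch. 3 I.10 (Dis)]
[cite: CossartJannsenSaito2020, Def. 6.38] -/
theorem isoInsepTowerTerminates₂_of_RC_K3 (h0 : IsoInsepE0Impossible₂.{u} 3) (h1 : IsoInsepE1Impossible₂.{u} 3)
    (hc : IsoInsepNonDoubleRecurrentImpossible₂.{u} 3) (hRC : IsoInsepE2SuccRational₂.{u} 3) (hP : IsoInsepE2Propagates₂.{u} 3)
    (hK3 : IsoSatelliteRecurrentImpossible.{u} 2 3) : IsoInsepTowerTerminates.{u} 2 3 :=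
  isoInsepTowerTerminates₂_of_RC_K1_K3 h0 h1 hc hRC hP (IsoTailsHS.isoFreeRationalTailsImpossible_holds 2) hK3

end Summit.ResolutionOfSingularities.ResolutionOfSingularities.Cruxes.SigmaMaxModifications.IdeasL1C6

end
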